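import Mathlib.Topology.MetricSpace.Holder
import Mathlib.Analysis.SpecialFunctions.Pow.Real
import Literature.Analysis.FluidPDE.SelfSimilar
import Literature.Analysis.FluidPDE.SuitableWeak
import HarnessLib

/-!
# Nonexistence of asymptotically self-similar singularities, local version (Chae 2007)

Analysis/FluidPDE fact file, companion of `Literature/Analysis/FluidPDE/SelfSimilarLiouville.lean`
(exact backward self-similar blow-up: `necas_ruzicka_sverak`, `tsai_selfsimilar`,
`tsai_selfsimilar_local_energy`). Physical space is `ℝ³ = EuclideanSpace ℝ (Fin 3)`, velocities are
`v : ℝ → ℝ³ → ℝ³` (time first), all vocabulary is the tree's (`IsClassicalNSSolutionOn`,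
`ContinuousInLpOn`, `parabolicCylinder`, `lerayBackward`) plus Mathlib (`MemLp`, `eLpNorm`,
`HolderOnWith`, `Filter.Tendsto`, `𝓝[<]`).

## Contents

* `chaeLocalDeviation T z q R v V t` — Chae's scaled local deviation of `v` from the backward
  self-similar field with profile `V` centred at the space–time point `(T, z)`:
  `(T−t)^{(q−3)/(2q)} · sup_{t<τ<T} ‖v(·,τ) − (T−τ)^{-1/2} V((· − z)/√(T−τ))‖_{L^q(B(z, R√(T−t)))}`
  (the quantity in display (i) of Chae 2007, Thm 1.5), an honest `ℝ≥0∞`.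
* `chae2007_asymptoticallySelfSimilar_local` (**named fact**; Chae, Math. Ann. 338 (2007),
  Theorem 1.5 = arXiv:math/0604234, pp. 4–5): let `p ∈ [3, ∞)` and let `v ∈ C([0,T); L^p(ℝ³))` be
  a classical solution of Navier–Stokes (`ν = 1`, no force). Suppose EITHER (i) `q ∈ [3, ∞)` and
  for some `V̄ ∈ L^p(ℝ³)` and some `R ∈ (0, ∞)` the deviation above tends to `0` as `t ↑ T`, OR
  (ii) `q ∈ [2, 3)` and for some `V̄ ∈ L^p(ℝ³)` it tends to `0` for every `R ∈ (0, ∞)`. Then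
  `V̄ = 0`, and `v` is Hölder continuous near `(z, T)` in the space and time variables.
* `chae2007_asymptoticallySelfSimilar_local.exact_selfSimilar` (**proved** from the fact; Chae
  2007, Corollary 1.3, "an immediate corollary of Theorem 1.5 (i)", the local version of
  Nečas–Růžička–Šverák / Tsai): if `v(x,t) = (T−t)^{-1/2} V̄((x−z)/√(T−t))` on
  `B(z,r) × (T−r², T)` for some `r > 0`, the same conclusion holds (take `q = 3`, `R = 1`: the
  deviation vanishes identically for `T − r² < t < T`).
* `lerayBackward_half_apply` (proved, `rfl` up to `2·½ = 1`): Chae's profile normalisation is the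
  tree's Leray backward field with `a = ½`, `(T−τ)^{-1/2} V((x−z)/√(T−τ)) = lerayBackward ½ T V τ (x − z)`,
  so that the sinks `necas_ruzicka_sverak` / `tsai_selfsimilar` (profile system with `a = ½`,
  i.e. Chae's Leray system `½V̄ + ½(y·∇)V̄ + (V̄·∇)V̄ = −∇P̄ + ΔV̄` after his factor-2 rescaling)
  speak about the same object.

## The printed statement and its rendering

Chae 2007, Theorem 1.5 (arXiv pp. 4–5, verbatim up to notation): "Let `p ∈ [3, ∞)`, and
`v ∈ C([0, T); L^p(ℝ³))` be a classical solution to (NS). Suppose either one of the followings hold.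
(i) Let `q ∈ [3, ∞)`. Suppose there exists `V̄ ∈ L^p(ℝ³)` and `R ∈ (0, ∞)` such that
`lim_{t↑T} (T−t)^{(q−3)/(2q)} sup_{t<τ<T} ‖v(·,τ) − (T−τ)^{-1/2} V̄((·−z)/√(T−τ))‖_{L^q(B(z, R√(T−t)))} = 0`.
(ii) Let `q ∈ [2, 3)`. Suppose there exists `V̄ ∈ L^p(ℝ³)` such that [the same] holds for all
`R ∈ (0, ∞)`. Then, `V̄ = 0`, and `v(x,t)` is Hölder continuous near `(z,T)` in the space and the
time variables." Here (NS) is `∂ₜv + (v·∇)v = −∇p + Δv`, `div v = 0` on `ℝ³ × (0, ∞)`,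
`v(·,0) = v₀` (arXiv p. 4, §1.2: unit viscosity, no force), and "classical solution
`v ∈ C([0,T); L^p)`" refers to Kato's `L^p` solution, "smooth for all `t ∈ (0, T)`" (p. 4, after
Thm 1.3). Proof in print (pp. 7–8): the similarity variables turn the hypothesis into
`V(·,s) → V̄` in `L^q_loc`, so `V̄` is a weak solution of Leray's profile system, hence `V̄ = 0` by
NRŠ (`p = 3`) / Tsai (`p > 3`); the hypothesis then becomes the smallness of
`r^{(q−3)/q} sup_{T−r²<τ<T} ‖v(τ)‖_{L^q(B(z,r))}` as `r ↓ 0`, and the ε-regularity criterion of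
Gustafson–Kang–Tsai (CMP 273 (2007), Thm 1.1; Chae's Thm 3.1) gives Hölder continuity near `(z,T)`.

Rendering choices.
* **Classes.** `v` is a classical solution on the *open* time interval, `IsClassicalNSSolutionOn
  (Ioo 0 T) 1 0 v π` for some smooth pressure `π` (smoothness at `t = 0` is not asserted in print:
  the datum is only `L^p`), together with `ContinuousInLpOn (Ico 0 T) p v` (`v ∈ C([0,T); L^p)`).
  A classical solution in this class is a very weak solution in `C([0,T); L^p)`, `p ≥ 3`, hence
  Kato's mild solution (Fabes–Jones–Rivière; uniqueness in `C_t L^p`), so nothing is gained or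
  lost against print. Users with a classical solution on `Ico 0 T` restrict by
  `IsClassicalNSSolutionOn.mono` (`Ioo 0 T ⊆ Ico 0 T`, `uniqueDiffOn_Ioo`); users with viscosity
  `ν ≠ 1` rescale `v(t,x) ↦ ν⁻¹ v(ν⁻¹ t, x)` first (not done here: the fact keeps Chae's `ν = 1`).
* **Exponents.** `p q : ℝ≥0` (so `p, q < ∞` automatically, as in print), coerced to `ℝ≥0∞` in
  `MemLp`/`eLpNorm`/`ContinuousInLpOn` and to `ℝ` in the real power `(T−t)^{(q−3)/(2q)}`
  (`Real.rpow`; the base `T − t` is positive on `𝓝[<] T`, the only filter used).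
* **Honest `ℝ≥0∞`.** The deviation is `ENNReal.ofReal ((T−t)^{…}) * ⨆ τ ∈ Ioo t T, eLpNorm … q
  (volume.restrict (ball z (R√(T−t))))`: no real `sSup` junk; a slice difference outside `L^q` of
  the ball makes the deviation `∞` (the power factor is `> 0` for `t < T`), so `Tendsto … (𝓝 0)`
  forces the finiteness implicit in print.
* **Conclusions.** `V̄ ∈ L^p` enters only through integrals, so "`V̄ = 0`" (in `L^p`) is
  `V =ᵐ[volume] 0`. "Hölder continuous near `(z,T)` in the space and the time variables" — for a
  field living on `t < T` — is rendered as: for some `r > 0`, `uncurry v` is Hölder (Mathlib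
  `HolderOnWith C α`, some exponent `α > 0`, product (sup) metric on `ℝ × ℝ³`) on the backward
  parabolic cylinder `parabolicCylinder r (T, z) = (T−r², T) × B(z, r)`, the neighbourhoods of
  Gustafson–Kang–Tsai's criterion. On such a bounded cylinder, Hölder for the parabolic metric
  and for the product metric are equivalent up to halving the exponent, and `α > 1` reduces to
  `α = 1`, so the existential form is insensitive to these conventions. In particular `v` is
  bounded near `(z, T)`: `(T, z)` is not a blow-up point.
* `0 < T` is explicit; `z ∈ ℝ³` is arbitrary, as in print.

## What is NOT here

Chae's global version Thm 1.4 (convergence in `L^p(ℝ³)`, conclusion `V̄ = 0` and continuation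
`v ∈ C([0,T+δ); L^p)`), the continuation principle Thm 1.3 / Cor 1.2, and the Euler part
(Thms 1.1–1.2, Cor 1.1) are not vendored (no user yet); neither is the Gustafson–Kang–Tsai
ε-regularity criterion used in the printed proof (it would live next to `ckn_epsilon_regularity`).
Only the local theorem, the sink of crux `NoScaleFreeTouchdown` of route
`NavierStokesRegularity/ComplexTouchdown`, is stated, as a named fact (not proved here: its proof
needs the similarity-variable weak limit, NRŠ/Tsai for *weak* `L^p` profiles and GKT).

## References

* D. Chae, *Nonexistence of asymptotically self-similar singularities in the Euler and the
  Navier–Stokes equations*, Math. Ann. 338 (2007) 435–449 = arXiv:math/0604234, Theorems 1.3–1.5,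
  Corollaries 1.2–1.3 (arXiv pp. 4–5), proofs §3 (pp. 7–8) [Chae2007].
* J. Nečas, M. Růžička, V. Šverák, Acta Math. 176 (1996) 283–294, Thm 1 [NecasRuzickaSverak1996].
* T.-P. Tsai, Arch. Rational Mech. Anal. 143 (1998) 29–51, Thm 1 [Tsai1998].
* S. Gustafson, K. Kang, T.-P. Tsai, *Interior regularity criteria for suitable weak solutions of
  the Navier–Stokes equations*, Comm. Math. Phys. 273 (2007) 161–176, Thm 1.1 (Chae's Thm 3.1)
  [GustafsonKangTsai2007].
-/

noncomputable section

open _root_.MeasureTheory Set Function Filter Metric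
open scoped NNReal ENNReal _root_.Topology

namespace Literature.Analysis.FluidPDE

/-- Local notation for physical space `ℝ³ = EuclideanSpace ℝ (Fin 3)`. -/
local notation "ℝ³" => EuclideanSpace ℝ (Fin 3)

/-! ### Chae's scaled local deviation from a backward self-similar profile -/

/-- **Chae's scaled local deviation** of the field `v` from the backward self-similar field with
profile `V` centred at the space–time point `(T, z)`, in `L^q` on the shrinking balls
`B(z, R√(T−t))` (Chae 2007, Thm 1.5, the quantity under `lim_{t↑T}` in (i)):
`chaeLocalDeviation T z q R v V t
  = (T−t)^{(q−3)/(2q)} · sup_{t<τ<T} ‖v(·,τ) − (T−τ)^{-1/2} V((· − z)/√(T−τ))‖_{L^q(B(z, R√(T−t)))}`,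
an extended nonnegative real (`∞` if some slice difference is not in `L^q` of the ball). The
comparison field is `lerayBackward ½ T V τ (x − z)` (`lerayBackward_half_apply`). Meaningful for
`t < T` (for `t ≥ T` the supremum is over the empty set and the value is `0`). [cite: Chae2007, Thm 1.5 (i)] -/
def chaeLocalDeviation (T : ℝ) (z : ℝ³) (q : ℝ≥0) (R : ℝ) (v : ℝ → ℝ³ → ℝ³) (V : ℝ³ → ℝ³)
    (t : ℝ) : ℝ≥0∞ :=
  ENNReal.ofReal ((T - t) ^ (((q : ℝ) - 3) / (2 * (q : ℝ)))) *
    ⨆ τ ∈ Ioo t T, eLpNorm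
      (fun x => v τ x - (Real.sqrt (T - τ))⁻¹ • V ((Real.sqrt (T - τ))⁻¹ • (x - z)))
      (q : ℝ≥0∞) (volume.restrict (ball z (R * Real.sqrt (T - t))))

/-- Unfolding `chaeLocalDeviation` (Chae 2007, Thm 1.5 (i)). [cite: Chae2007, Thm 1.5 (i)] -/
theorem chaeLocalDeviation_def (T : ℝ) (z : ℝ³) (q : ℝ≥0) (R : ℝ) (v : ℝ → ℝ³ → ℝ³)
    (V : ℝ³ → ℝ³) (t : ℝ) :
    chaeLocalDeviation T z q R v V t =
      ENNReal.ofReal ((T - t) ^ (((q : ℝ) - 3) / (2 * (q : ℝ)))) *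
        ⨆ τ ∈ Ioo t T, eLpNorm
          (fun x => v τ x - (Real.sqrt (T - τ))⁻¹ • V ((Real.sqrt (T - τ))⁻¹ • (x - z)))
          (q : ℝ≥0∞) (volume.restrict (ball z (R * Real.sqrt (T - t)))) :=
  rfl

/-- Chae's profile normalisation `(T−τ)^{-1/2} V(y/√(T−τ))` is the tree's Leray backward field
`lerayBackward a T V` with `a = ½` (`√(2·½·(T−τ)) = √(T−τ)`; Chae 2007, Cor 1.2 and (3.3):
`v(x,t) = (T−t)^{-1/2} V(x/√(T−t))`). [cite: Chae2007, Cor 1.2] -/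
theorem lerayBackward_half_apply (T : ℝ) (V : ℝ³ → ℝ³) (τ : ℝ) (y : ℝ³) :
    lerayBackward (1 / 2) T V τ y = (Real.sqrt (T - τ))⁻¹ • V ((Real.sqrt (T - τ))⁻¹ • y) := by
  simp [lerayBackward]

/-! ### Chae 2007, Theorem 1.5 -/

/-- **Local nonexistence of asymptotically self-similar singularities** (Chae, Math. Ann. 338
(2007), Theorem 1.5 = arXiv:math/0604234 pp. 4–5). Let `p ∈ [3, ∞)`, `T > 0`, and let
`v ∈ C([0,T); L^p(ℝ³))` be a classical solution of the Navier–Stokes equations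
`∂ₜv + (v·∇)v = −∇π + Δv`, `div v = 0` on `ℝ³ × (0, T)` (unit viscosity, no force; classical on
the open interval, `v ∈ C([0,T); L^p)` — Kato's class). Let `z ∈ ℝ³`. Suppose EITHER
(i) `q ∈ [3, ∞)` and there are `V̄ ∈ L^p(ℝ³)` and `R ∈ (0, ∞)` with
`lim_{t↑T} (T−t)^{(q−3)/(2q)} sup_{t<τ<T} ‖v(·,τ) − (T−τ)^{-1/2} V̄((·−z)/√(T−τ))‖_{L^q(B(z, R√(T−t)))} = 0`
(`chaeLocalDeviation T z q R v V̄ → 0` along `𝓝[<] T`), OR (ii) `q ∈ [2, 3)` and there is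
`V̄ ∈ L^p(ℝ³)` for which this holds for every `R ∈ (0, ∞)`. Then `V̄ = 0` (in `L^p`, i.e. a.e.),
and `v` is Hölder continuous near `(z, T)` in the space and time variables: `uncurry v` is
`α`-Hölder, some `α > 0`, on a backward parabolic cylinder `(T − r², T) × B(z, r)`, `r > 0`
(rendering discussed in the module docstring). A named fact; printed proof: similarity variables
+ Nečas–Růžička–Šverák/Tsai + Gustafson–Kang–Tsai ε-regularity. [cite: Chae2007, Thm 1.5 (arXiv pp. 4–5)] -/
def chae2007_asymptoticallySelfSimilar_local : Prop :=
  ∀ ⦃T : ℝ⦄ (_hT : 0 < T) ⦃p : ℝ≥0⦄ (_hp : 3 ≤ p) ⦃v : ℝ → ℝ³ → ℝ³⦄ ⦃π : ℝ → ℝ³ → ℝ⦄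
    (_hv : IsClassicalNSSolutionOn (Ioo 0 T) 1 0 v π) (_hvc : ContinuousInLpOn (Ico 0 T) p v)
    (z : ℝ³) ⦃V : ℝ³ → ℝ³⦄ (_hV : MemLp V (p : ℝ≥0∞) volume) ⦃q : ℝ≥0⦄
    (_hq : (3 ≤ q ∧ ∃ R : ℝ, 0 < R ∧ Tendsto (chaeLocalDeviation T z q R v V) (𝓝[<] T) (𝓝 0)) ∨
      (2 ≤ q ∧ q < 3 ∧
        ∀ R : ℝ, 0 < R → Tendsto (chaeLocalDeviation T z q R v V) (𝓝[<] T) (𝓝 0))),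
    V =ᵐ[volume] 0 ∧
      ∃ r > 0, ∃ C α : ℝ≥0, 0 < α ∧ HolderOnWith C α (uncurry v) (parabolicCylinder r (T, z))

/-! ### Chae 2007, Corollary 1.3 (proved from Theorem 1.5 (i)) -/

/-- If `v` coincides with the backward self-similar field on `B(z, r) × (T − r², T)`, Chae's
deviation with `R = 1` vanishes identically for `T − r² < t < T` (any `q`): the balls
`B(z, √(T−t))` lie in `B(z, r)` and the times `τ ∈ (t, T)` in `(T − r², T)` (the observation
behind "immediate corollary", Chae 2007, before Cor 1.3). [cite: Chae2007, Cor 1.3] -/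
theorem chaeLocalDeviation_eq_zero_of_repr {T : ℝ} {z : ℝ³} {q : ℝ≥0} {v : ℝ → ℝ³ → ℝ³}
    {V : ℝ³ → ℝ³} {r : ℝ} (hr : 0 < r)
    (hrepr : ∀ τ ∈ Ioo (T - r ^ 2) T, ∀ x ∈ ball z r,
      v τ x = (Real.sqrt (T - τ))⁻¹ • V ((Real.sqrt (T - τ))⁻¹ • (x - z)))
    {t : ℝ} (ht : t ∈ Ioo (T - r ^ 2) T) :
    chaeLocalDeviation T z q 1 v V t = 0 := by
  rw [chaeLocalDeviation_def]
  have hball : ball z (1 * Real.sqrt (T - t)) ⊆ ball z r := by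
    refine ball_subset_ball ?_
    rw [one_mul]
    exact ((Real.sqrt_lt' hr).2 (by linarith [ht.1])).le
  have hsup : (⨆ τ ∈ Ioo t T, eLpNorm
      (fun x => v τ x - (Real.sqrt (T - τ))⁻¹ • V ((Real.sqrt (T - τ))⁻¹ • (x - z)))
      (q : ℝ≥0∞) (volume.restrict (ball z (1 * Real.sqrt (T - t))))) = 0 := by
    refine ENNReal.iSup_eq_zero.2 fun τ => ENNReal.iSup_eq_zero.2 fun hτ => ?_
    have hτ' : τ ∈ Ioo (T - r ^ 2) T := ⟨ht.1.trans hτ.1, hτ.2⟩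
    have hae : (fun x => v τ x - (Real.sqrt (T - τ))⁻¹ • V ((Real.sqrt (T - τ))⁻¹ • (x - z)))
        =ᵐ[volume.restrict (ball z (1 * Real.sqrt (T - t)))] 0 := by
      refine (ae_restrict_iff' measurableSet_ball).2 (Eventually.of_forall fun x hx => ?_)
      simp [hrepr τ hτ' x (hball hx)]
    rw [eLpNorm_congr_ae hae, eLpNorm_zero]
  rw [hsup, mul_zero]

/-- **Chae 2007, Corollary 1.3** (local version of Nečas–Růžička–Šverák / Tsai), *proved* from
the named fact `chae2007_asymptoticallySelfSimilar_local` exactly as in print ("an immediate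
corollary of Theorem 1.5 (i)"): let `p ∈ [3, ∞)`, `v ∈ C([0,T); L^p(ℝ³))` a classical solution
of (NS) on `ℝ³ × (0,T)`, and suppose `v(x,t) = (T−t)^{-1/2} V̄((x−z)/√(T−t))` for all
`(x,t) ∈ B(z,r) × (T−r², T)`, some `V̄ ∈ L^p(ℝ³)`, `r > 0`. Then `V̄ = 0` (a.e.) and `v` is Hölder
continuous near `(z, T)`. Proof: with `q = 3`, `R = 1` the deviation vanishes identically for
`T − r² < t < T` (`chaeLocalDeviation_eq_zero_of_repr`), hence tends to `0`. [cite: Chae2007, Cor 1.3 (arXiv p. 5)] -/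
theorem chae2007_asymptoticallySelfSimilar_local.exact_selfSimilar
    (h : chae2007_asymptoticallySelfSimilar_local) {T : ℝ} (hT : 0 < T) {p : ℝ≥0} (hp : 3 ≤ p)
    {v : ℝ → ℝ³ → ℝ³} {π : ℝ → ℝ³ → ℝ} (hv : IsClassicalNSSolutionOn (Ioo 0 T) 1 0 v π)
    (hvc : ContinuousInLpOn (Ico 0 T) p v) (z : ℝ³) {V : ℝ³ → ℝ³}
    (hV : MemLp V (p : ℝ≥0∞) volume) {r : ℝ} (hr : 0 < r)
    (hrepr : ∀ τ ∈ Ioo (T - r ^ 2) T, ∀ x ∈ ball z r,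
      v τ x = (Real.sqrt (T - τ))⁻¹ • V ((Real.sqrt (T - τ))⁻¹ • (x - z))) :
    V =ᵐ[volume] 0 ∧
      ∃ r > 0, ∃ C α : ℝ≥0, 0 < α ∧ HolderOnWith C α (uncurry v) (parabolicCylinder r (T, z)) := by
  refine h hT hp hv hvc z hV (q := 3) (Or.inl ⟨le_rfl, 1, one_pos, ?_⟩)
  have hmem : Ioo (T - r ^ 2) T ∈ 𝓝[<] T := Ioo_mem_nhdsLT (by nlinarith)
  refine tendsto_const_nhds.congr' ?_
  filter_upwards [hmem] with t ht
  exact (chaeLocalDeviation_eq_zero_of_repr hr hrepr ht).symm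

end Literature.Analysis.FluidPDE
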